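import Literature.NumberTheory.GaloisRepresentations.IdeleClassBarSOpenSubgroupLayer
import Literature.NumberTheory.GaloisRepresentations.IdeleClassModUnitsSInvariant
import Literature.NumberTheory.GaloisRepresentations.IdeleClassBarModPairingValues
import HarnessLib

/-!
# Milne's pairing values for `(Gal(K_S/L), Res C̄_S)` are invariants of cup products in the idèle class layers `C_E`
# (Milne ADT I Lemma 1.7, §4; Harari Thm. 17.2; Tate, C–F VII §11.3)

Topic `NumberTheory/GaloisRepresentations`; namespace `Literature.NumberTheory.GaloisRepresentations.IdeleClassBar`.  The S-port
of door-c4 g16's `IdeleClassBarModPairingValues.lean` (§23–§25 there, formation `(Γ_F, C̄)`) to the `S`-idèle class formation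
`(G_S, C̄_S = classBarSD K S)`
    (bsd-line-x1-p1-w3's D1-(ii)) at the open subgroup `W = V̄_L = layerSubgroupS S L = Gal(K_S/L)` of a
layer `L ⊆ K_S`, relative to a layer `E ⊇ L`, `E ⊆ K_S`.  Two definitions with bodies (PLUMBING: a group isomorphism and a
group homomorphism) and theorems; no named fact, no instance, no notation, no `sorry`.

THE INVARIANT MAP IS A PARAMETER.  Brick D2-CF (bsd-line-x1-p1-w5) supplies `inv_S` and hence door-c4's
`invAt (classBarSD K S) inv_S U = inv_S ∘ cores_U`; this file takes ANY additive
`inv : Ext²_{C_{↥W}}(ℤ, Res_W C̄_S) → ℚ/ℤ` with the hypothesis `hinv` that its value on the classes inflated from the trace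
    layer
of `E` is the RELATIVE `S`-INVARIANT at `H = subgroupImageS S hE W ≤ Gal(E/K)` of Harari's layer `C_S(E) = C_E ⧸ U_{E,S}`
(bsd-line-x1-p1-w5's `IsClassModule.invSub` of `isClassModule_classModUnitsCocycle`, read through bsd-line-x1-p1-w3's
`relLayerSCohomologyIso`) — the shape in which D2-CF describes `invAt`.

* §1 `traceQuotEquivSubgroupImage S L hE : ↥V̄_L ⧸ (V̄_E ∩ V̄_L) ≃* H_E` onto THE TEMPLATE'S subgroup
  `H_E = GalLayer.subgroupImage U_L E` of `Gal(E/K)`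
      (bsd-line-x1-p1-w3's `subgroupImageSEquiv` + `subgroupImageS V̄_L = subgroupImage U_L E`),
  `galToTraceQuotS S h hE : Gal(E/L) →* ↥V̄_L ⧸ (V̄_E ∩ V̄_L)`; `invSub_map_subgroupCongr`
      (relative invariants along `H₁ = H₂`).
* §2 the vector of `φ : ℤ ⟶ Res_{V̄_L} C̄_S` is `[c]` for an idèle class `c ∈ C_L` (`exists_ofLayerS_eq_hom_one`), reads `π_E
    (c_E)`
  in the layer `E` (`relLayerSEquiv_homToLayer_one`, `c_E = transHom L E c`), and `c_E` is `Gal(E/L)`-invariant.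
* §3 the comparisons of `groupCohomology.map` composites: `map_subgroupCongr_relLayerSCohomologyIso_map_homToLayer`
  (pushing along `homToLayer φ` = `H²(C_E ↠ C_S(E))` of the cup product with `c_E`) and
      `subgroupImageToGalCohomology_map_smulHom`
  (door-c4's `T` moves it to `H²(Gal(E/L), C_E)`).
* §4 **`inv_inflG_eq_classInvAll_of_hinv`** — THE DICTIONARY: for every `inv` satisfying `hinv`,
  `inv (Inf (H²(id, φ_V) (β_m χ))) = inv_{E/L} (H²(id, r ↦ r • c_E) (β_m (χ ∘ g_S)))` — verbatim the right-hand side of the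
  template's `layerPairingValue_eq_classInvAll` (with `x_E := c_E`), so that door-c4 g16/g17's `…ModPairingArtin` /
  `…ModAlphaOneInjective/Surjective` computations port line by line (sequel files).

Cell `bsd-eis`, background lane «PT-Ш-S-TC» of crux `GoodLatticeBDPValue` (stmt-BirchSwinnertonDyer-19032), brick D2-(b)
(`adjointBijective_one_zmod_pow` for `(G_S, C̄_S)` = Milne ADT I Thm. 1.8 (b) for the `S`-idèle class formation), seat
bsd-line-x1-p1-w8 g12.  HONEST FRAMING: bookkeeping between door-c4's layer currency and the finite-layer class modules; no
duality theorem, no case of Poitou–Tate and no case of BSD is proved here.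

## References
* J. S. Milne, *Arithmetic Duality Theorems* (2nd ed. 2006), I §1 Lemma 1.7, Theorem 1.8 (b); I §4. [MilneADT2006]
* D. Harari, *Galois Cohomology and Class Field Theory*, Universitext (2020), §17.1 Theorem 17.2. [Harari2020]
* J. W. S. Cassels, A. Fröhlich (eds.), *Algebraic Number Theory* (1967), Ch. VII (J. Tate) §11.3. [CasselsFrohlichANT1967]
* J.-P. Serre, *Galois Cohomology* (1997), I §2.2 Proposition 8. [SerreGaloisCohomology1997]
* J.-P. Serre, *Local Fields*, GTM 67 (1979), XI §3. [Serre1979]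
-/

noncomputable section

open NumberField IsDedekindDomain CategoryTheory CategoryTheory.Limits groupCohomology
open Field (absoluteGaloisGroup)
open Literature.NumberTheory.Automorphic Literature.NumberTheory.Automorphic.IdeleClassGroup
open Literature.NumberTheory.NumberFields
open Literature.Algebra.Homology Literature.Algebra.Homology.DiscreteRep
open Literature.NumberTheory.GaloisRepresentations.LocalWeilDatum (galFixing)
open scoped Classical

namespace Literature.NumberTheory.GaloisRepresentations

namespace IdeleClassBar

/-! ## §1. `↥V̄_L ⧸ (V̄_E ∩ V̄_L) ≃* H_E`, `Gal(E/L) → ↥V̄_L ⧸ (V̄_E ∩ V̄_L)`, relative invariants along equal subgroups -/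

/-- The identity on vectors as a morphism `Res_{e⁻¹} (Res_{H₁} A) ⟶ Res_{H₂} A` along `e = MulEquiv.subgroupCongr (H₁ = H₂)`
(transport of structure between EQUAL subgroups). [cite: Serre1979, XI §3] -/
def resSubgroupCongrHom {G : Type} [Group G] (A : Rep.{0} ℤ G) {H₁ H₂ : Subgroup G} (heq : H₁ = H₂) :
    Rep.res (MulEquiv.subgroupCongr heq).symm.toMonoidHom (Rep.res H₁.subtype A) ⟶ Rep.res H₂.subtype A :=
  letI := (Rep.res H₁.subtype A).hV2
  Rep.ofHom ⟨LinearMap.id, fun _ => LinearMap.ext fun _ => rfl⟩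

/-- Formula: `resSubgroupCongrHom` is the identity on vectors. [cite: Serre1979, XI §3] -/
theorem resSubgroupCongrHom_hom_apply {G : Type} [Group G] (A : Rep.{0} ℤ G) {H₁ H₂ : Subgroup G} (heq : H₁ = H₂)
    (x : A.V) : (resSubgroupCongrHom A heq).hom x = x := rfl

/-- **Relative invariants along an equality of subgroups**: for a class module `(A, φ)` of a finite group `G` and subgroups
`H₁ = H₂`, transporting a class of `H²(H₁, Res A)` to `H²(H₂, Res A)` along `MulEquiv.subgroupCongr` (identity on vectors)
does not change its relative invariant. [cite: Serre1979, XI §3] -/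
theorem invSub_map_subgroupCongr {G : Type} [Group G] [Finite G] {A : Rep.{0} ℤ G} {φ : cocycles₂ A}
    (hA : IsClassModule A φ) {H₁ H₂ : Subgroup G} (heq : H₁ = H₂) (y : groupCohomology (Rep.res H₁.subtype A) 2) :
    hA.invSub H₂ (groupCohomology.map (MulEquiv.subgroupCongr heq).symm.toMonoidHom (resSubgroupCongrHom A heq) 2 y) =
      hA.invSub H₁ y := by
  subst heq
  have hmap : groupCohomology.map (MulEquiv.subgroupCongr (rfl : H₁ = H₁)).symm.toMonoidHom (resSubgroupCongrHom A rfl) 2 =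
      𝟙 _ := by
    rw [← groupCohomology.map_id]
    exact map_congr' (MonoidHom.ext fun _ => rfl) _ _ (fun _ => rfl) 2
  rw [hmap]
  rfl

/-- **Bookkeeping for `groupCohomology.map` composites** (generic groups and representations): a composite
`H(id, φ) ≫ H(e_S⁻¹, r) ≫ H(e_C⁻¹, t)` out of the cohomology of the trivial module `ℤ` equals `H((e_S e_C)⁻¹, u) ≫ H(id, s) ≫
    H(id, p)`
as soon as the underlying maps of vectors agree at `1 ∈ ℤ` (`t (r (φ 1)) = p (s (u 1))`; Mathlib `groupCohomology.map_comp`,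
door-c6 `map_congr'`, `ℤ`-linearity). Stated for abstract representations so that no concrete representation is unfolded by the
rewriting. [cite: Serre1979, VII §5] -/
theorem map_comp₃_eq_map_comp₃ {Q H₁ H₂ : Type} [Group Q] [Group H₁] [Group H₂]
    {B : Rep.{0} ℤ Q} {A₁ : Rep.{0} ℤ H₁} {A₂ T M : Rep.{0} ℤ H₂} (eS : Q ≃* H₁) (eC : H₁ ≃* H₂)
    (φ : Rep.trivial ℤ Q ℤ ⟶ B) (r : Rep.res eS.symm.toMonoidHom B ⟶ A₁) (t : Rep.res eC.symm.toMonoidHom A₁ ⟶ A₂)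
    (u : Rep.res (eS.trans eC).symm.toMonoidHom (Rep.trivial ℤ Q ℤ) ⟶ T) (s : T ⟶ M) (p : M ⟶ A₂)
    (hcomm : t.hom (r.hom (φ.hom (1 : ℤ))) = p.hom (s.hom (u.hom (1 : ℤ)))) (n : ℕ) :
    groupCohomology.map (MonoidHom.id Q) φ n ≫ groupCohomology.map eS.symm.toMonoidHom r n ≫
        groupCohomology.map eC.symm.toMonoidHom t n =
      groupCohomology.map (eS.trans eC).symm.toMonoidHom u n ≫ groupCohomology.map (MonoidHom.id H₂) s n ≫
        groupCohomology.map (MonoidHom.id H₂) p n := by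
  -- the `ℤ`-module structures carried by the `Rep` objects (cf. door-c5 `GalLayerSystemLayers`)
  letI := A₂.hV2
  letI := (Rep.trivial ℤ Q ℤ).hV2
  rw [← groupCohomology.map_comp, ← groupCohomology.map_comp, ← groupCohomology.map_id_comp,
    ← groupCohomology.map_comp]
  refine map_congr' (MonoidHom.ext fun _ => rfl) _ _ (fun x => ?_) n
  -- both sides are `ℤ`-linear in `x ∈ ℤ`: compare them at `x = 1`
  rw [← Representation.IntertwiningMap.toLinearMap_apply, ← Representation.IntertwiningMap.toLinearMap_apply]
  exact LinearMap.congr_fun (LinearMap.ext_ring (R := ℤ) (S := ℤ) (σ := RingHom.id ℤ) hcomm) x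

variable {K : Type} [Field K] [NumberField K] (S : Finset (HeightOneSpectrum (𝓞 K))) {L E : GalLayer K}

variable (L) in
/-- **`e : ↥V̄_L ⧸ (V̄_E ∩ V̄_L) ≃* H_E`** onto the template's `H_E = GalLayer.subgroupImage U_L E ≤ Gal(E/K)` (the image of
`U_L = Gal(K̄/L)`): bsd-line-x1-p1-w3's `subgroupImageSEquiv` followed by `subgroupImageS V̄_L = subgroupImage U_L E`.
[cite: SerreGaloisCohomology1997, I §2.2 Proposition 8] -/
def traceQuotEquivSubgroupImage (hE : ramificationSubgroup K (↑S : Set (HeightOneSpectrum (𝓞 K))) ≤ galFixing K E.1) :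
    (layerSubgroupS S L : Subgroup (GaloisGroupUnramifiedOutside K (↑S : Set (HeightOneSpectrum (𝓞 K))))) ⧸
        (DiscreteRep.traceOpenNormalSubgroup
            (layerSubgroupS S L : Subgroup (GaloisGroupUnramifiedOutside K (↑S : Set (HeightOneSpectrum (𝓞 K)))))
                (layerSubgroupS S E) :
          Subgroup (layerSubgroupS S L : Subgroup (GaloisGroupUnramifiedOutside K (↑S : Set (HeightOneSpectrum (𝓞 K)))))) ≃*
      GalLayer.subgroupImage (L.openNormalSubgroup : Subgroup (absoluteGaloisGroup K)) E :=
  (subgroupImageSEquiv S hE (layerSubgroupS S L : Subgroup _)).trans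
    (MulEquiv.subgroupCongr (subgroupImageS_layerSubgroupS_eq_subgroupImage S hE L))

/-- Formula: `(e [w] : Gal(E/K)) = w|_E`. [cite: SerreGaloisCohomology1997, I §2.2 Proposition 8] -/
theorem coe_traceQuotEquivSubgroupImage_mk (hE : ramificationSubgroup K (↑S : Set (HeightOneSpectrum (𝓞 K))) ≤ galFixing K E.1)
    (w : (layerSubgroupS S L : Subgroup (GaloisGroupUnramifiedOutside K (↑S : Set (HeightOneSpectrum (𝓞 K)))))) :
    ((traceQuotEquivSubgroupImage S L hE (QuotientGroup.mk w) :
        GalLayer.subgroupImage (L.openNormalSubgroup : Subgroup (absoluteGaloisGroup K)) E) : E.1 ≃ₐ[K] E.1) =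
      restrictHomS S hE (w : GaloisGroupUnramifiedOutside K (↑S : Set (HeightOneSpectrum (𝓞 K)))) := rfl

/-- **`g_S : Gal(E/L) →* ↥V̄_L ⧸ (V̄_E ∩ V̄_L)`**: door-c4 g16's `galEquivSubgroupImage` followed by `e⁻¹` (the S-version of the
template's `galToTraceQuot`). [cite: Serre1979, XI §1 (iv)][cite: SerreGaloisCohomology1997, I §2.2 Proposition 8] -/
def galToTraceQuotS (h : L ≤ E) (hE : ramificationSubgroup K (↑S : Set (HeightOneSpectrum (𝓞 K))) ≤ galFixing K E.1) :
    (letI := GalLayer.algebraOfLE h; (E.1 ≃ₐ[L.1] E.1)) →*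
      (layerSubgroupS S L : Subgroup (GaloisGroupUnramifiedOutside K (↑S : Set (HeightOneSpectrum (𝓞 K))))) ⧸
        (DiscreteRep.traceOpenNormalSubgroup
            (layerSubgroupS S L : Subgroup (GaloisGroupUnramifiedOutside K (↑S : Set (HeightOneSpectrum (𝓞 K)))))
                (layerSubgroupS S E) :
          Subgroup (layerSubgroupS S L : Subgroup (GaloisGroupUnramifiedOutside K (↑S : Set (HeightOneSpectrum (𝓞 K)))))) :=
  (traceQuotEquivSubgroupImage S L hE).symm.toMonoidHom.comp (galEquivSubgroupImage h).toMonoidHom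

/-! ## §2. The vector of `φ : ℤ ⟶ Res_{V̄_L} C̄_S`: an idèle class `c ∈ C_L`, read `π_E(c_E)` in the layer `E` -/

/-- **The vector `φ(1) ∈ C̄_S^{V̄_L}` of `φ : ℤ ⟶ Res_{V̄_L} C̄_S` is the class of an idèle class `c ∈ C_L`**
(`C̄_S^{Gal(K_S/L)} = im C_L`, bsd-line-x1-p1-w3's `exists_ofLayerS_eq_of_forall_mem`).
[cite: Harari2020, §17.1 Theorem 17.2][cite: MilneADT2006, I §4] -/
theorem exists_ofLayerS_eq_hom_one (hL : ramificationSubgroup K (↑S : Set (HeightOneSpectrum (𝓞 K))) ≤ galFixing K L.1)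
    (φ : triv (k := ℤ) (Γ := (layerSubgroupS S L : Subgroup (GaloisGroupUnramifiedOutside K (↑S : Set (HeightOneSpectrum
        (𝓞 K)))))) ℤ ⟶
      (resD ℤ (layerSubgroupS S L : Subgroup (GaloisGroupUnramifiedOutside K (↑S : Set (HeightOneSpectrum (𝓞 K)))))).obj
        (classBarSD K S)) :
    ∃ c : layerClass K L, ofLayerS S hL c = φ.hom.hom (1 : ℤ) := by
  refine exists_ofLayerS_eq_of_forall_mem S hL _ fun σ hσ => ?_
  exact (Rep.hom_comm_apply φ.hom ⟨QuotientGroup.mk σ, mk_mem_layerSubgroupS S L hσ⟩ (1 : ℤ)).symm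

/-- **In the layer `E ⊇ L` the vector reads `π_E (c_E)`**
    (`c_E = transHom L E c ∈ C_E`, `π_E : C_E ↠ C_S(E)`): bsd-line-x1-p1-w3's
`relLayerSEquiv` of the value at `1` of door-c4's layer morphism `homToLayer φ` is `π_E (c_E)`.
[cite: CasselsFrohlichANT1967, Ch. VII §11.3][cite: Harari2020, §17.1 Theorem 17.2] -/
theorem relLayerSEquiv_homToLayer_one (h : L ≤ E)
    (hL : ramificationSubgroup K (↑S : Set (HeightOneSpectrum (𝓞 K))) ≤ galFixing K L.1)
    (hE : ramificationSubgroup K (↑S : Set (HeightOneSpectrum (𝓞 K))) ≤ galFixing K E.1)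
    (φ : triv (k := ℤ) (Γ := (layerSubgroupS S L : Subgroup (GaloisGroupUnramifiedOutside K (↑S : Set (HeightOneSpectrum
        (𝓞 K)))))) ℤ ⟶
      (resD ℤ (layerSubgroupS S L : Subgroup (GaloisGroupUnramifiedOutside K (↑S : Set (HeightOneSpectrum (𝓞 K)))))).obj
        (classBarSD K S))
    {c : layerClass K L} (hc : ofLayerS S hL c = φ.hom.hom (1 : ℤ)) :
    relLayerSEquiv S hE (layerSubgroupS_anti S h)
        ((LayerColimit.homToLayer
          (DiscreteRep.traceOpenNormalSubgroup
              (layerSubgroupS S L : Subgroup (GaloisGroupUnramifiedOutside K (↑S : Set (HeightOneSpectrum (𝓞 K)))))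
                  (layerSubgroupS S E) :
            Subgroup (layerSubgroupS S L : Subgroup (GaloisGroupUnramifiedOutside K (↑S : Set (HeightOneSpectrum
                (𝓞 K)))))) _ φ).hom
          (1 : ℤ)) =
      (haveI := E.numberField; (cokernel.π (IdeleCohomology.unitsOffToClass (F := K) (E := E.1) S)).hom
          (transHom L E h c)) := by
  have heq : (LayerColimit.homToLayer
      (DiscreteRep.traceOpenNormalSubgroup
          (layerSubgroupS S L : Subgroup (GaloisGroupUnramifiedOutside K (↑S : Set (HeightOneSpectrum (𝓞 K)))))
              (layerSubgroupS S E) :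
        Subgroup (layerSubgroupS S L : Subgroup (GaloisGroupUnramifiedOutside K (↑S : Set (HeightOneSpectrum (𝓞 K)))))) _ φ).hom
        (1 : ℤ) =
      (relToLayerS S (layerSubgroupS_anti S h)).symm (toLayerS S hE (transHom L E h c)) := by
    apply Subtype.ext
    rw [LayerColimit.homToLayer_hom_apply_coe, coe_relToLayerS_symm_toLayerS, ofLayerS_transHom S h hL hE, hc]
  rw [heq, relLayerSEquiv_symm_toLayerS]

/-- `U_L = Gal(K̄/L)` fixes `c_E = transHom L E c` (`c ∈ C_L`): `u|_E • c_E = (u • c)_E = c_E`.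
[cite: CasselsFrohlichANT1967, Ch. VII §11.3] -/
theorem galoisRep_ρ_restrictHom_transHom (h : L ≤ E) (c : layerClass K L) {u : absoluteGaloisGroup K}
    (hu : u ∈ (L.openNormalSubgroup : Subgroup (absoluteGaloisGroup K))) :
    (haveI := E.numberField; (IdeleClassGroup.galoisRep K E.1).ρ (E.restrictHom u) (transHom L E h c)) = transHom L E h c := by
  haveI := E.numberField
  haveI := E.isGalois
  rw [IdeleClassGroup.galoisRep_ρ_apply, GalLayer.restrictHom_apply, ← layerAct_apply, ← transHom_layerAct h u c,
    layerAct_eq_self_of_mem_fixingSubgroup L ((GalLayer.mem_openNormalSubgroup_iff L u).1 hu) c]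

/-- **`c_E` is `H_E`-invariant** (as a vector of `Res_{H_E} C_E`).
[cite: CasselsFrohlichANT1967, Ch. VII §11.3] -/
theorem res_subgroupImage_ρ_transHom (h : L ≤ E) (c : layerClass K L)
    (τ : GalLayer.subgroupImage (L.openNormalSubgroup : Subgroup (absoluteGaloisGroup K)) E) :
    (haveI := E.numberField;
      (Rep.res (GalLayer.subgroupImage (L.openNormalSubgroup : Subgroup (absoluteGaloisGroup K)) E).subtype
        (IdeleClassGroup.galoisRep K E.1)).ρ τ (transHom L E h c)) = transHom L E h c := by
  haveI := E.numberField
  have hs := GalLayer.toSubgroupImage_surjective (L.openNormalSubgroup : Subgroup (absoluteGaloisGroup K)) E τ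
  obtain ⟨u, hu⟩ := hs
  subst hu
  exact galoisRep_ρ_restrictHom_transHom h c u.2

/-- **`c_E` is `Gal(E/L)`-invariant** (as a vector of `galoisRep L E`; the template's `layerVector_invariant`).
[cite: CasselsFrohlichANT1967, Ch. VII §11.3] -/
theorem galoisRep_ρ_transHom (h : L ≤ E) (c : layerClass K L) (σ : (letI := GalLayer.algebraOfLE h; (E.1 ≃ₐ[L.1] E.1))) :
    (letI := GalLayer.algebraOfLE h; haveI := L.numberField; haveI := E.numberField;
      (IdeleClassGroup.galoisRep L.1 E.1).ρ σ (transHom L E h c)) = transHom L E h c := by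
  letI := GalLayer.algebraOfLE h
  haveI := GalLayer.isScalarTower_of_le h
  haveI := L.numberField
  haveI := E.numberField
  -- `σ|^K = u|_E` for some `u ∈ U_L`
  obtain ⟨u, hu⟩ := GalLayer.toSubgroupImage_surjective (L.openNormalSubgroup : Subgroup (absoluteGaloisGroup K)) E
    (galEquivSubgroupImage h σ)
  have hσ : galResHom h σ = E.restrictHom (u : absoluteGaloisGroup K) := by
    rw [← coe_galEquivSubgroupImage h σ, ← hu, GalLayer.coe_toSubgroupImage_apply]
  have hρ : (IdeleClassGroup.galoisRep L.1 E.1).ρ σ (transHom L E h c) =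
      (classData K).ρ E (E.restrictHom (u : absoluteGaloisGroup K)) (transHom L E h c) := by
    rw [← hσ, IdeleClassGroup.galoisRep_ρ_apply, AlgEquiv.restrictScalarsHom_apply,
      ← IdeleClassGroup.classGalAct_restrictScalars (F := K), ← IdeleClassGroup.galoisRep_ρ_apply]
    rfl
  rw [hρ]
  exact galoisRep_ρ_restrictHom_transHom h c u.2

/-! ## §3. The comparisons of the `groupCohomology.map` composites -/

set_option maxHeartbeats 1600000 in
-- instantiating the generic bookkeeping lemma elaborates the large layer objects against each other
/-- **Pushing along `homToLayer φ`, read in `H²(H_E, Res C_S(E))`, is `H²(C_E ↠ C_S(E))` of the cup product with `c_E` after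
pulling back to `H_E`** — as an identity of morphisms `H²(↥V̄_L ⧸ (V̄_E ∩ V̄_L), ℤ) ⟶ H²(H_E, Res C_S(E))`:
`transport ∘ relIso ∘ H²(id, homToLayer φ) = H²(id, Res π_E) ∘ H²(id, r ↦ r • c_E) ∘ H²(e⁻¹, 𝟙)`
(bsd-line-x1-p1-w3's `relLayerSCohomologyIso`, §1's transport to `H_E`, door-c6's `smulHom`, Harari's `π_E`).
[cite: CasselsFrohlichANT1967, Ch. VII §11.3][cite: Serre1979, XI §3] -/
theorem homToLayer_relLayerSCohomologyIso_transport (h : L ≤ E)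
    (hL : ramificationSubgroup K (↑S : Set (HeightOneSpectrum (𝓞 K))) ≤ galFixing K L.1)
    (hE : ramificationSubgroup K (↑S : Set (HeightOneSpectrum (𝓞 K))) ≤ galFixing K E.1)
    (φ : triv (k := ℤ) (Γ := (layerSubgroupS S L : Subgroup (GaloisGroupUnramifiedOutside K (↑S : Set (HeightOneSpectrum
        (𝓞 K)))))) ℤ ⟶
      (resD ℤ (layerSubgroupS S L : Subgroup (GaloisGroupUnramifiedOutside K (↑S : Set (HeightOneSpectrum (𝓞 K)))))).obj
        (classBarSD K S))
    {c : layerClass K L} (hc : ofLayerS S hL c = φ.hom.hom (1 : ℤ)) (n : ℕ) :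
    (haveI := E.numberField;
      groupCohomology.map (A := Rep.trivial ℤ ((layerSubgroupS S L : Subgroup (GaloisGroupUnramifiedOutside K (↑S : Set
          (HeightOneSpectrum (𝓞 K))))) ⧸
        (DiscreteRep.traceOpenNormalSubgroup
            (layerSubgroupS S L : Subgroup (GaloisGroupUnramifiedOutside K (↑S : Set (HeightOneSpectrum (𝓞 K)))))
                (layerSubgroupS S E) :
          Subgroup (layerSubgroupS S L : Subgroup (GaloisGroupUnramifiedOutside K (↑S : Set (HeightOneSpectrum (𝓞 K))))))) ℤ)
              (MonoidHom.id _)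
          (LayerColimit.homToLayer (DiscreteRep.traceOpenNormalSubgroup (layerSubgroupS S L : Subgroup
              (GaloisGroupUnramifiedOutside K (↑S : Set (HeightOneSpectrum (𝓞 K))))) (layerSubgroupS S E) : Subgroup
              (layerSubgroupS S L : Subgroup (GaloisGroupUnramifiedOutside K (↑S : Set (HeightOneSpectrum (𝓞 K)))))) ((resD ℤ
              (layerSubgroupS S L : Subgroup (GaloisGroupUnramifiedOutside K (↑S : Set (HeightOneSpectrum (𝓞 K)))))).obj
              (classBarSD K S)) φ) n ≫
        (relLayerSCohomologyIso S hE (layerSubgroupS_anti S h) n).hom ≫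
          groupCohomology.map (MulEquiv.subgroupCongr (subgroupImageS_layerSubgroupS_eq_subgroupImage S hE L)).symm.toMonoidHom
            (resSubgroupCongrHom (IdeleCohomology.classModUnitsRep K E.1 S)
              (subgroupImageS_layerSubgroupS_eq_subgroupImage S hE L)) n) =
      (haveI := E.numberField;
        groupCohomology.map (A := Rep.trivial ℤ ((layerSubgroupS S L : Subgroup (GaloisGroupUnramifiedOutside K (↑S : Set
            (HeightOneSpectrum (𝓞 K))))) ⧸
        (DiscreteRep.traceOpenNormalSubgroup
            (layerSubgroupS S L : Subgroup (GaloisGroupUnramifiedOutside K (↑S : Set (HeightOneSpectrum (𝓞 K)))))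
                (layerSubgroupS S E) :
          Subgroup (layerSubgroupS S L : Subgroup (GaloisGroupUnramifiedOutside K (↑S : Set (HeightOneSpectrum (𝓞 K))))))) ℤ)
            (traceQuotEquivSubgroupImage S L hE).symm.toMonoidHom (𝟙 (Rep.trivial ℤ (GalLayer.subgroupImage
                (L.openNormalSubgroup : Subgroup (absoluteGaloisGroup K)) E) ℤ)) n ≫
          groupCohomology.map (A := Rep.trivial ℤ (GalLayer.subgroupImage (L.openNormalSubgroup : Subgroup
              (absoluteGaloisGroup K)) E) ℤ) (MonoidHom.id _)
              (Unramified.smulHom (Rep.res (GalLayer.subgroupImage (L.openNormalSubgroup : Subgroup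
                  (absoluteGaloisGroup K)) E).subtype (IdeleClassGroup.galoisRep K E.1))
                (transHom L E h c) (res_subgroupImage_ρ_transHom h c)) n ≫
            groupCohomology.map (A := Rep.res (GalLayer.subgroupImage (L.openNormalSubgroup : Subgroup
                (absoluteGaloisGroup K)) E).subtype (IdeleClassGroup.galoisRep K E.1)) (MonoidHom.id _)
              (Rep.resMap (GalLayer.subgroupImage (L.openNormalSubgroup : Subgroup (absoluteGaloisGroup K)) E).subtype
                  (cokernel.π (IdeleCohomology.unitsOffToClass (F := K) (E := E.1) S)) :
                Rep.res (GalLayer.subgroupImage (L.openNormalSubgroup : Subgroup (absoluteGaloisGroup K)) E).subtype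
                    (IdeleClassGroup.galoisRep K E.1) ⟶
                  Rep.res (GalLayer.subgroupImage (L.openNormalSubgroup : Subgroup (absoluteGaloisGroup K)) E).subtype
                      (IdeleCohomology.classModUnitsRep K E.1 S)) n) := by
  haveI := E.numberField
  refine map_comp₃_eq_map_comp₃ (subgroupImageSEquiv S hE (layerSubgroupS S L : Subgroup (GaloisGroupUnramifiedOutside K
      (↑S : Set (HeightOneSpectrum (𝓞 K))))))
    (MulEquiv.subgroupCongr (subgroupImageS_layerSubgroupS_eq_subgroupImage S hE L)) _ _ _ _ _ _ ?_ n
  -- the two vectors at `1 ∈ ℤ`: `relLayerSEquiv ((homToLayer φ) 1) = π_E (c_E) = π_E (1 • c_E)`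
  change relLayerSEquiv S hE (layerSubgroupS_anti S h) ((LayerColimit.homToLayer (DiscreteRep.traceOpenNormalSubgroup
      (layerSubgroupS S L : Subgroup (GaloisGroupUnramifiedOutside K (↑S : Set (HeightOneSpectrum (𝓞 K)))))
      (layerSubgroupS S E) : Subgroup (layerSubgroupS S L : Subgroup (GaloisGroupUnramifiedOutside K (↑S : Set
      (HeightOneSpectrum (𝓞 K)))))) _ φ).hom (1 : ℤ)) =
    (cokernel.π (IdeleCohomology.unitsOffToClass (F := K) (E := E.1) S)).hom
      ((Unramified.smulHom (Rep.res (GalLayer.subgroupImage (L.openNormalSubgroup : Subgroup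
          (absoluteGaloisGroup K)) E).subtype (IdeleClassGroup.galoisRep K E.1))
        (transHom L E h c) (res_subgroupImage_ρ_transHom h c)).hom (1 : ℤ))
  rw [Unramified.smulHom_apply, relLayerSEquiv_homToLayer_one S h hL hE φ hc]
  exact congrArg _ (one_smul ℤ (transHom L E h c)).symm

set_option maxHeartbeats 1600000 in
-- as above (three composites)
/-- **Door-c4's `T` moves the cup product to `Gal(E/L)`**: `T (H²(id, r ↦ r • c_E) (H²(e⁻¹, 𝟙) z)) = H²(id, r ↦ r • c_E)
    (H²(g_S, 𝟙) z)`
in `H²(Gal(E/L), C_E)` (`T = subgroupImageToGalCohomology h 2`, `g_S = e⁻¹ ∘ galEquivSubgroupImage`).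
[cite: CasselsFrohlichANT1967, Ch. VII §11.3 (12)][cite: Serre1979, XI §1] -/
theorem subgroupImageToGalCohomology_map_smulHom (h : L ≤ E)
    (hE : ramificationSubgroup K (↑S : Set (HeightOneSpectrum (𝓞 K))) ≤ galFixing K E.1) (c : layerClass K L) {m : ℕ}
    (z : groupCohomology (Bockstein.intModShortComplex
      ((layerSubgroupS S L : Subgroup (GaloisGroupUnramifiedOutside K (↑S : Set (HeightOneSpectrum (𝓞 K))))) ⧸
        (DiscreteRep.traceOpenNormalSubgroup
            (layerSubgroupS S L : Subgroup (GaloisGroupUnramifiedOutside K (↑S : Set (HeightOneSpectrum (𝓞 K)))))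
                (layerSubgroupS S E) :
          Subgroup (layerSubgroupS S L : Subgroup (GaloisGroupUnramifiedOutside K (↑S : Set (HeightOneSpectrum
              (𝓞 K))))))) m).X₁ 2) :
    subgroupImageToGalCohomology h 2
        (haveI := E.numberField;
          groupCohomology.map (MonoidHom.id _)
            (Unramified.smulHom
              (Rep.res (GalLayer.subgroupImage (L.openNormalSubgroup : Subgroup (absoluteGaloisGroup K)) E).subtype
                (IdeleClassGroup.galoisRep K E.1))
              (transHom L E h c) (res_subgroupImage_ρ_transHom h c)) 2
            (groupCohomology.map (traceQuotEquivSubgroupImage S L hE).symm.toMonoidHom (𝟙 (Rep.trivial ℤ _ ℤ)) 2 z)) =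
      (letI := GalLayer.algebraOfLE h; haveI := L.numberField; haveI := E.numberField;
        groupCohomology.map (MonoidHom.id _)
          (Unramified.smulHom (IdeleClassGroup.galoisRep L.1 E.1) (transHom L E h c) (galoisRep_ρ_transHom h c)) 2
          (groupCohomology.map (galToTraceQuotS S h hE) (𝟙 (Rep.trivial ℤ _ ℤ)) 2 z)) := by
  letI := GalLayer.algebraOfLE h
  haveI := GalLayer.isScalarTower_of_le h
  haveI := L.numberField
  haveI := E.numberField
  rw [← ModuleCat.comp_apply, ← ModuleCat.comp_apply, subgroupImageToGalCohomology, ← groupCohomology.map_comp,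
    ← groupCohomology.map_comp, ← ModuleCat.comp_apply, ← groupCohomology.map_comp]
  refine DFunLike.congr_fun (congrArg ModuleCat.Hom.hom ?_) z
  exact map_congr' (MonoidHom.ext fun _ => rfl) _ _ (fun _ => rfl) 2

/-! ## §4. The dictionary: Milne's pairing values are invariants of cup products in `C_E` -/

set_option maxHeartbeats 1600000 in
-- the `Eq.trans` steps unify the large layer / cohomology terms of §3 against their directly elaborated forms
/-- **Step 1 (S-side).**  Under `hinv`, `inv (Inf (H²(id, φ_V) (β_m χ)))` is the relative invariant AT `H_E` OF `C_E` (any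
class-module structure representing `u_{E/K}`, here door-c5's `layerCocycle`) of the class `H²(id, r ↦ r • c_E) (H²(e⁻¹, 𝟙)
    (β_m χ))`:
chain `hinv`; §1's transport `subgroupImageS V̄_L = H_E`; §3; bsd-line-x1-p1-w5's `invSub_classModUnits_iso_hom`
("`inv^S_H ∘ H²(π_E) = inv_H`", its isomorphism `H²(H, C_E) ⥲ H²(H, C_S(E))` being `H²(id, Res π_E)` by `rfl`).
[cite: Harari2020, §17.1 Theorem 17.2][cite: Serre1979, XI §3] -/
theorem inv_inflG_eq_invSub_of_hinv (h : L ≤ E)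
    (hL : ramificationSubgroup K (↑S : Set (HeightOneSpectrum (𝓞 K))) ≤ galFixing K L.1)
    (hE : ramificationSubgroup K (↑S : Set (HeightOneSpectrum (𝓞 K))) ≤ galFixing K E.1)
    (hSE : ∀ v : HeightOneSpectrum (𝓞 K), v ∉ S → (haveI := E.numberField; Algebra.IsUnramifiedIn (𝓞 E.1) v.asIdeal))
    {m : ℕ} (hm : 0 < m)
    (inv : Abelian.Ext (triv (k := ℤ) (Γ := (layerSubgroupS S L : Subgroup (GaloisGroupUnramifiedOutside K (↑S : Set
        (HeightOneSpectrum (𝓞 K)))))) ℤ)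
      ((resD ℤ (layerSubgroupS S L : Subgroup (GaloisGroupUnramifiedOutside K (↑S : Set (HeightOneSpectrum (𝓞 K)))))).obj
        (classBarSD K S)) 2 →+ AddCircle (1 : ℚ))
    (hinv : ∀ x : groupCohomology (relLayerRepS S (layerSubgroupS S L : Subgroup (GaloisGroupUnramifiedOutside K (↑S : Set
        (HeightOneSpectrum (𝓞 K))))) E) 2,
      inv (LayerColimit.inflG (DiscreteRep.traceOpenNormalSubgroup (layerSubgroupS S L : Subgroup
          (GaloisGroupUnramifiedOutside K (↑S : Set (HeightOneSpectrum (𝓞 K))))) (layerSubgroupS S E))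
          ((resD ℤ (layerSubgroupS S L : Subgroup (GaloisGroupUnramifiedOutside K (↑S : Set (HeightOneSpectrum (𝓞 K)))))).obj
              (classBarSD K S)) 2 x) =
        (haveI := E.numberField; haveI := E.isGalois; haveI := finite_gal K E;
          (IdeleCohomology.isClassModule_classModUnitsCocycle S hSE).invSub
            (subgroupImageS S hE (layerSubgroupS S L : Subgroup (GaloisGroupUnramifiedOutside K (↑S : Set (HeightOneSpectrum
                (𝓞 K))))))
            ((relLayerSCohomologyIso S hE (layerSubgroupS_anti S h) 2).hom x)))
    (φ : triv (k := ℤ) (Γ := (layerSubgroupS S L : Subgroup (GaloisGroupUnramifiedOutside K (↑S : Set (HeightOneSpectrum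
        (𝓞 K)))))) ℤ ⟶
      (resD ℤ (layerSubgroupS S L : Subgroup (GaloisGroupUnramifiedOutside K (↑S : Set (HeightOneSpectrum (𝓞 K)))))).obj
        (classBarSD K S))
    {c : layerClass K L} (hc : ofLayerS S hL c = φ.hom.hom (1 : ℤ))
    (χ : groupCohomology (Rep.trivial ℤ ((layerSubgroupS S L : Subgroup (GaloisGroupUnramifiedOutside K (↑S : Set
        (HeightOneSpectrum (𝓞 K))))) ⧸
        (DiscreteRep.traceOpenNormalSubgroup
            (layerSubgroupS S L : Subgroup (GaloisGroupUnramifiedOutside K (↑S : Set (HeightOneSpectrum (𝓞 K)))))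
                (layerSubgroupS S E) :
          Subgroup (layerSubgroupS S L : Subgroup (GaloisGroupUnramifiedOutside K (↑S : Set (HeightOneSpectrum (𝓞 K)))))))
              (ZMod m)) 1) :
    haveI : NeZero m := ⟨hm.ne'⟩
    inv (LayerColimit.inflG (DiscreteRep.traceOpenNormalSubgroup (layerSubgroupS S L : Subgroup
        (GaloisGroupUnramifiedOutside K (↑S : Set (HeightOneSpectrum (𝓞 K))))) (layerSubgroupS S E))
        ((resD ℤ (layerSubgroupS S L : Subgroup (GaloisGroupUnramifiedOutside K (↑S : Set (HeightOneSpectrum (𝓞 K)))))).obj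
            (classBarSD K S)) 2
        (groupCohomology.map (MonoidHom.id _)
          (LayerColimit.homToLayer (DiscreteRep.traceOpenNormalSubgroup (layerSubgroupS S L : Subgroup
              (GaloisGroupUnramifiedOutside K (↑S : Set (HeightOneSpectrum (𝓞 K))))) (layerSubgroupS S E) : Subgroup
              (layerSubgroupS S L : Subgroup (GaloisGroupUnramifiedOutside K (↑S : Set (HeightOneSpectrum (𝓞 K))))))
            ((resD ℤ (layerSubgroupS S L : Subgroup (GaloisGroupUnramifiedOutside K (↑S : Set (HeightOneSpectrum
                (𝓞 K)))))).obj (classBarSD K S)) φ) 2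
          (groupCohomology.δ (Bockstein.intModShortComplex_shortExact ((layerSubgroupS S L : Subgroup
              (GaloisGroupUnramifiedOutside K (↑S : Set (HeightOneSpectrum (𝓞 K))))) ⧸
        (DiscreteRep.traceOpenNormalSubgroup
            (layerSubgroupS S L : Subgroup (GaloisGroupUnramifiedOutside K (↑S : Set (HeightOneSpectrum (𝓞 K)))))
                (layerSubgroupS S E) :
          Subgroup (layerSubgroupS S L : Subgroup (GaloisGroupUnramifiedOutside K (↑S : Set (HeightOneSpectrum
              (𝓞 K))))))) m) 1 2 rfl χ))) =
      (haveI := E.numberField; haveI := finite_gal K E;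
        (isClassModule_layerCocycle K E).invSub (GalLayer.subgroupImage (L.openNormalSubgroup : Subgroup
            (absoluteGaloisGroup K)) E)
          (groupCohomology.map (MonoidHom.id _)
            (Unramified.smulHom (Rep.res (GalLayer.subgroupImage (L.openNormalSubgroup : Subgroup
                (absoluteGaloisGroup K)) E).subtype (IdeleClassGroup.galoisRep K E.1))
              (transHom L E h c) (res_subgroupImage_ρ_transHom h c)) 2
          (groupCohomology.map (traceQuotEquivSubgroupImage S L hE).symm.toMonoidHom (𝟙 (Rep.trivial ℤ _ ℤ)) 2
            (groupCohomology.δ (Bockstein.intModShortComplex_shortExact ((layerSubgroupS S L : Subgroup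
                (GaloisGroupUnramifiedOutside K (↑S : Set (HeightOneSpectrum (𝓞 K))))) ⧸
        (DiscreteRep.traceOpenNormalSubgroup
            (layerSubgroupS S L : Subgroup (GaloisGroupUnramifiedOutside K (↑S : Set (HeightOneSpectrum (𝓞 K)))))
                (layerSubgroupS S E) :
          Subgroup (layerSubgroupS S L : Subgroup (GaloisGroupUnramifiedOutside K (↑S : Set (HeightOneSpectrum
              (𝓞 K))))))) m) 1 2 rfl χ)))) := by
  haveI : NeZero m := ⟨hm.ne'⟩
  haveI := E.numberField
  haveI := E.isGalois
  haveI := E.finiteDimensional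
  haveI := finite_gal K E
  rw [hinv, ← invSub_map_subgroupCongr (IdeleCohomology.isClassModule_classModUnitsCocycle S hSE)
      (subgroupImageS_layerSubgroupS_eq_subgroupImage S hE L)]
  -- §3: `transport (relIso (H²(id, homToLayer φ) (β χ))) = H²(id, Res π_E) (H²(id, r ↦ r • c_E) (H²(e⁻¹, 𝟙) (β χ)))`
  have happ := DFunLike.congr_fun (congrArg ModuleCat.Hom.hom (homToLayer_relLayerSCohomologyIso_transport S h hL hE φ hc 2))
    (groupCohomology.δ (Bockstein.intModShortComplex_shortExact ((layerSubgroupS S L : Subgroup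
        (GaloisGroupUnramifiedOutside K (↑S : Set (HeightOneSpectrum (𝓞 K))))) ⧸
        (DiscreteRep.traceOpenNormalSubgroup
            (layerSubgroupS S L : Subgroup (GaloisGroupUnramifiedOutside K (↑S : Set (HeightOneSpectrum (𝓞 K)))))
                (layerSubgroupS S E) :
          Subgroup (layerSubgroupS S L : Subgroup (GaloisGroupUnramifiedOutside K (↑S : Set (HeightOneSpectrum
              (𝓞 K))))))) m) 1 2 rfl χ)
  simp only [ModuleCat.hom_comp] at happ
  refine (congrArg ((IdeleCohomology.isClassModule_classModUnitsCocycle S hSE).invSub (GalLayer.subgroupImage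
      (L.openNormalSubgroup : Subgroup (absoluteGaloisGroup K)) E)) happ).trans ?_
  -- bsd-line-x1-p1-w5's `inv^S_H ∘ H²(π|_H) = inv_H`
  exact IdeleCohomology.invSub_classModUnits_iso_hom S hSE (isClassModule_layerCocycle K E) (H2π_layerCocycle K E)
      (GalLayer.subgroupImage (L.openNormalSubgroup : Subgroup (absoluteGaloisGroup K)) E) _

/-- **Step 2 (class field theory of `E/L`).**  The relative invariant at `H_E` of `C_E` is the invariant map of the base field
`L` after door-c4's `T` (door-c4 g16's `invSub_apply_eq_classInvAll`), and `T` moves the cup product to `H²(Gal(E/L), C_E)`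
(§3), the Bockstein commuting with `g_S` (door-c6 `Bockstein.map_δ_intMod`).
[cite: CasselsFrohlichANT1967, Ch. VII §11.3][cite: Serre1979, XI §3] -/
theorem invSub_smulHom_eq_classInvAll (h : L ≤ E)
    (hE : ramificationSubgroup K (↑S : Set (HeightOneSpectrum (𝓞 K))) ≤ galFixing K E.1) {m : ℕ} (hm : 0 < m)
    (c : layerClass K L) (χ : groupCohomology (Rep.trivial ℤ ((layerSubgroupS S L : Subgroup (GaloisGroupUnramifiedOutside K
        (↑S : Set (HeightOneSpectrum (𝓞 K))))) ⧸
        (DiscreteRep.traceOpenNormalSubgroup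
            (layerSubgroupS S L : Subgroup (GaloisGroupUnramifiedOutside K (↑S : Set (HeightOneSpectrum (𝓞 K)))))
                (layerSubgroupS S E) :
          Subgroup (layerSubgroupS S L : Subgroup (GaloisGroupUnramifiedOutside K (↑S : Set (HeightOneSpectrum (𝓞 K)))))))
              (ZMod m)) 1) :
    haveI : NeZero m := ⟨hm.ne'⟩
    (haveI := E.numberField; haveI := finite_gal K E;
      (isClassModule_layerCocycle K E).invSub (GalLayer.subgroupImage (L.openNormalSubgroup : Subgroup
          (absoluteGaloisGroup K)) E)
        (groupCohomology.map (MonoidHom.id _)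
            (Unramified.smulHom (Rep.res (GalLayer.subgroupImage (L.openNormalSubgroup : Subgroup
                (absoluteGaloisGroup K)) E).subtype (IdeleClassGroup.galoisRep K E.1))
              (transHom L E h c) (res_subgroupImage_ρ_transHom h c)) 2
          (groupCohomology.map (traceQuotEquivSubgroupImage S L hE).symm.toMonoidHom (𝟙 (Rep.trivial ℤ _ ℤ)) 2
            (groupCohomology.δ (Bockstein.intModShortComplex_shortExact ((layerSubgroupS S L : Subgroup
                (GaloisGroupUnramifiedOutside K (↑S : Set (HeightOneSpectrum (𝓞 K))))) ⧸
        (DiscreteRep.traceOpenNormalSubgroup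
            (layerSubgroupS S L : Subgroup (GaloisGroupUnramifiedOutside K (↑S : Set (HeightOneSpectrum (𝓞 K)))))
                (layerSubgroupS S E) :
          Subgroup (layerSubgroupS S L : Subgroup (GaloisGroupUnramifiedOutside K (↑S : Set (HeightOneSpectrum
              (𝓞 K))))))) m) 1 2 rfl χ)))) =
      (letI := GalLayer.algebraOfLE h; haveI := GalLayer.isScalarTower_of_le h; haveI := L.numberField;
        haveI := E.numberField; haveI := E.isGalois; haveI : IsGalois L.1 E.1 := IsGalois.tower_top_of_isGalois K L.1 E.1;
        IdeleCohomology.classInvAll L.1 E.1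
          (groupCohomology.map (MonoidHom.id _)
            (Unramified.smulHom (IdeleClassGroup.galoisRep L.1 E.1) (transHom L E h c) (galoisRep_ρ_transHom h c)) 2
            (groupCohomology.δ (Bockstein.intModShortComplex_shortExact _ m) 1 2 rfl
              (groupCohomology.map (galToTraceQuotS S h hE) (𝟙 (Rep.trivial ℤ _ (ZMod m))) 1 χ)))) := by
  haveI : NeZero m := ⟨hm.ne'⟩
  haveI := E.numberField
  -- door-c4 g16's `inv_{H_E} = inv_{E/L} ∘ T`
  refine (invSub_apply_eq_classInvAll h _).trans ?_
  rw [subgroupImageToGalCohomology_map_smulHom S h hE c, Bockstein.map_δ_intMod]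
  rfl

/-- **THE DICTIONARY for `(↥V̄_L, Res C̄_S)`.**  Let `inv : Ext²_{C_{↥V̄_L}}(ℤ, Res C̄_S) → ℚ/ℤ` be additive and satisfy
    `hinv`: on
the classes inflated from the trace layer of `E ⊇ L` (`E ⊆ K_S`) it is the relative `S`-invariant
`inv_H^S ∘ relLayerSCohomologyIso` at `H = subgroupImageS S hE V̄_L` (the shape of D2-CF's `invAt (classBarSD K S) inv_S V̄_L`).
Then for `φ : ℤ ⟶ Res_{V̄_L} C̄_S` with vector `[c]`, `c ∈ C_L`, and `χ ∈ H¹(↥V̄_L ⧸ (V̄_E ∩ V̄_L), ℤ/m)`: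
`inv (Inf (H²(id, φ_V) (β_m χ))) = inv_{E/L} (H²(id, r ↦ r • c_E) (β_m (H¹(g_S, 𝟙) χ)))` — door-c4 g16's `layerPairingValue
(Res C̄_S) inv hm (V̄_E ∩ V̄_L) φ χ` (the left-hand side, by `rfl`) is THE invariant map of `L` on door-c6's cup product in
`H²(Gal(E/L), C_E)`; verbatim the right-hand side of the template's `layerPairingValue_eq_classInvAll` with `x_E := c_E`.
[cite: MilneADT2006, I Lemma 1.7, Theorem 1.8
    (b)][cite: Harari2020, §17.1 Theorem 17.2][cite: CasselsFrohlichANT1967, Ch. VII §11.3] -/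
theorem inv_inflG_eq_classInvAll_of_hinv (h : L ≤ E)
    (hL : ramificationSubgroup K (↑S : Set (HeightOneSpectrum (𝓞 K))) ≤ galFixing K L.1)
    (hE : ramificationSubgroup K (↑S : Set (HeightOneSpectrum (𝓞 K))) ≤ galFixing K E.1)
    (hSE : ∀ v : HeightOneSpectrum (𝓞 K), v ∉ S → (haveI := E.numberField; Algebra.IsUnramifiedIn (𝓞 E.1) v.asIdeal))
    {m : ℕ} (hm : 0 < m)
    (inv : Abelian.Ext (triv (k := ℤ) (Γ := (layerSubgroupS S L : Subgroup (GaloisGroupUnramifiedOutside K (↑S : Set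
        (HeightOneSpectrum (𝓞 K)))))) ℤ)
      ((resD ℤ (layerSubgroupS S L : Subgroup (GaloisGroupUnramifiedOutside K (↑S : Set (HeightOneSpectrum (𝓞 K)))))).obj
        (classBarSD K S)) 2 →+ AddCircle (1 : ℚ))
    (hinv : ∀ x : groupCohomology (relLayerRepS S (layerSubgroupS S L : Subgroup (GaloisGroupUnramifiedOutside K (↑S : Set
        (HeightOneSpectrum (𝓞 K))))) E) 2,
      inv (LayerColimit.inflG (DiscreteRep.traceOpenNormalSubgroup (layerSubgroupS S L : Subgroup
          (GaloisGroupUnramifiedOutside K (↑S : Set (HeightOneSpectrum (𝓞 K))))) (layerSubgroupS S E))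
          ((resD ℤ (layerSubgroupS S L : Subgroup (GaloisGroupUnramifiedOutside K (↑S : Set (HeightOneSpectrum (𝓞 K)))))).obj
              (classBarSD K S)) 2 x) =
        (haveI := E.numberField; haveI := E.isGalois; haveI := finite_gal K E;
          (IdeleCohomology.isClassModule_classModUnitsCocycle S hSE).invSub
            (subgroupImageS S hE (layerSubgroupS S L : Subgroup (GaloisGroupUnramifiedOutside K (↑S : Set (HeightOneSpectrum
                (𝓞 K))))))
            ((relLayerSCohomologyIso S hE (layerSubgroupS_anti S h) 2).hom x)))
    (φ : triv (k := ℤ) (Γ := (layerSubgroupS S L : Subgroup (GaloisGroupUnramifiedOutside K (↑S : Set (HeightOneSpectrum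
        (𝓞 K)))))) ℤ ⟶
      (resD ℤ (layerSubgroupS S L : Subgroup (GaloisGroupUnramifiedOutside K (↑S : Set (HeightOneSpectrum (𝓞 K)))))).obj
        (classBarSD K S))
    {c : layerClass K L} (hc : ofLayerS S hL c = φ.hom.hom (1 : ℤ))
    (χ : groupCohomology (Rep.trivial ℤ ((layerSubgroupS S L : Subgroup (GaloisGroupUnramifiedOutside K (↑S : Set
        (HeightOneSpectrum (𝓞 K))))) ⧸
        (DiscreteRep.traceOpenNormalSubgroup
            (layerSubgroupS S L : Subgroup (GaloisGroupUnramifiedOutside K (↑S : Set (HeightOneSpectrum (𝓞 K)))))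
                (layerSubgroupS S E) :
          Subgroup (layerSubgroupS S L : Subgroup (GaloisGroupUnramifiedOutside K (↑S : Set (HeightOneSpectrum (𝓞 K)))))))
              (ZMod m)) 1) :
    haveI : NeZero m := ⟨hm.ne'⟩
    inv (LayerColimit.inflG (DiscreteRep.traceOpenNormalSubgroup (layerSubgroupS S L : Subgroup
        (GaloisGroupUnramifiedOutside K (↑S : Set (HeightOneSpectrum (𝓞 K))))) (layerSubgroupS S E))
        ((resD ℤ (layerSubgroupS S L : Subgroup (GaloisGroupUnramifiedOutside K (↑S : Set (HeightOneSpectrum (𝓞 K)))))).obj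
            (classBarSD K S)) 2
        (groupCohomology.map (MonoidHom.id _)
          (LayerColimit.homToLayer (DiscreteRep.traceOpenNormalSubgroup (layerSubgroupS S L : Subgroup
              (GaloisGroupUnramifiedOutside K (↑S : Set (HeightOneSpectrum (𝓞 K))))) (layerSubgroupS S E) : Subgroup
              (layerSubgroupS S L : Subgroup (GaloisGroupUnramifiedOutside K (↑S : Set (HeightOneSpectrum (𝓞 K))))))
            ((resD ℤ (layerSubgroupS S L : Subgroup (GaloisGroupUnramifiedOutside K (↑S : Set (HeightOneSpectrum
                (𝓞 K)))))).obj (classBarSD K S)) φ) 2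
          (groupCohomology.δ (Bockstein.intModShortComplex_shortExact ((layerSubgroupS S L : Subgroup
              (GaloisGroupUnramifiedOutside K (↑S : Set (HeightOneSpectrum (𝓞 K))))) ⧸
        (DiscreteRep.traceOpenNormalSubgroup
            (layerSubgroupS S L : Subgroup (GaloisGroupUnramifiedOutside K (↑S : Set (HeightOneSpectrum (𝓞 K)))))
                (layerSubgroupS S E) :
          Subgroup (layerSubgroupS S L : Subgroup (GaloisGroupUnramifiedOutside K (↑S : Set (HeightOneSpectrum
              (𝓞 K))))))) m) 1 2 rfl χ))) =
      (letI := GalLayer.algebraOfLE h; haveI := GalLayer.isScalarTower_of_le h; haveI := L.numberField;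
        haveI := E.numberField; haveI := E.isGalois; haveI : IsGalois L.1 E.1 := IsGalois.tower_top_of_isGalois K L.1 E.1;
        IdeleCohomology.classInvAll L.1 E.1
          (groupCohomology.map (MonoidHom.id _)
            (Unramified.smulHom (IdeleClassGroup.galoisRep L.1 E.1) (transHom L E h c) (galoisRep_ρ_transHom h c)) 2
            (groupCohomology.δ (Bockstein.intModShortComplex_shortExact _ m) 1 2 rfl
              (groupCohomology.map (galToTraceQuotS S h hE) (𝟙 (Rep.trivial ℤ _ (ZMod m))) 1 χ)))) :=
  (inv_inflG_eq_invSub_of_hinv S h hL hE hSE hm inv hinv φ hc χ).trans (invSub_smulHom_eq_classInvAll S h hE hm c χ)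

end IdeleClassBar

end Literature.NumberTheory.GaloisRepresentations

end
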